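import Summits.ValiantsHypothesis.ValiantsHypothesis.Theorems.KPlusLogSqLawTropicalCycleMonotone
import Summits.ValiantsHypothesis.ValiantsHypothesis.Theorems.KPlusLogSqLawTropicalBScaleSeparation

/-!
# Route «KPlusLogSqLaw», crux `TropicalB` (stmt-ValiantsHypothesis-19771) — ODOMETER LOCALITY:
# under super-increasing exponents every INVARIANT PART of a dominant step moves lexicographically, and no part of the step
# touches an exponent value above the step's leading value

HONEST FRAMING.  Helper lemmas toward the registered stub `stub_tropThin` of `Cruxes/TropicalB/Lines/birth.lean` (crux
`Summit.ValiantsHypothesis.ValiantsHypothesis.Theses.KPlusLogSqLaw.TropicalB`, item `stmt-ValiantsHypothesis-19771`, route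
`KPlusLogSqLaw`, DRAFT; cell `pub-symmetroid`, seat val-sym-trop-p1 g2).  Structure lemmas for the «lex» (scale-separated) sector
in which the cell's register constructions live (SHIFT-THREE, the `K = 4` fork designs): they REFINE val-sym-trop-p4's odometer law
`TropicalCensus.countVal_le_of_dominant_lex` (between consecutive dominant terms the exponent-value profile of the WHOLE term moves
lexicographically) from the full column set to every column set `T` invariant under the step's permutation quotient `σ₁⁻¹σ₂` (a
union of its cycles), using the cyclewise slope law `sum_d_lt_of_isDominant_invariant` (conjb-2 g4 / val-sym-trop-p4, file
`…TropicalCycleMonotone`) in place of the total slope law.  Everything is phrased with VALUE counts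
`#{i ∈ T : d (λ i) = D'}` (classes sharing an exponent value are indistinguishable by slopes).  Nothing here bounds `TropicalB`;
nothing bears on `KPlusLogSqLaw`, `Lifting`, DoorA26 / DoorA34, `MatrixDescartes` (`stmt-ValiantsHypothesis-18050`) or VP ≠ VNP.

RESULTS (exponents super-increasing by the size, `d l < d l' ⇒ m·d l < d l'`, as in `…ScaleSeparation`; `p = (σ₁, λ₁)` dominant
at `θa`, `q = (σ₂, λ₂)` dominant at `θb > θa`; `T` with `(σ₁⁻¹σ₂) b ∈ T ↔ b ∈ T`):
* `OdometerLocality.countVal_le_of_dominant_lex_on` — **lex law on an invariant part**: if `p ≠ q` somewhere on `T` and the two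
  terms have equally many `T`-columns of every exponent value `> d t`, then `#{b ∈ T : d(λ₁ b) = d t} ≤ #{b ∈ T : d(λ₂ b) = d t}`;
* `OdometerLocality.countAbove_eq_on` — **locality**: if on ALL columns the two terms have equally many columns of every exponent
  value `> D` (the step's leading value is `≤ D`), then the same holds on every invariant `T`: NO cycle of the step relocates a value
  above the leading one (descending induction on the value: at the largest value not yet treated the lex law on `T` and on `Tᶜ` gives
  `≤` on both parts, which add up to the total equality).
So in a lex design a «fast» step (in total only the lowest values move) is fast CYCLE BY CYCLE: each cycle of `σ₁⁻¹σ₂` keeps its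
count of every higher value and raises its lowest changing value — the located form of «high digits cannot be relocated during
low-digit steps» used in the register analyses (HOME/val-sym-trop-p1/RESET-MECHANISMS.md §1).  [folklore: exchange argument +
scale separation]
-/

-- `Summit.ValiantsHypothesis.ValiantsHypothesis.…` repeats a component by the D-0017 layout
-- (single-conjunct summit), which the `dupNamespace` linter flags; the name is mandated.
set_option linter.dupNamespace false
set_option autoImplicit false

namespace Summit.ValiantsHypothesis.ValiantsHypothesis.Theorems.KPlusLogSqLaw

open Summit.ValiantsHypothesis.ValiantsHypothesis.Theorems.MatrixDescartes.Negative
open Summit.ValiantsHypothesis.ValiantsHypothesis.Theorems.LacunarySymmetroidMatrixDescartes.TropicalCensus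
open Finset

namespace OdometerLocality

variable {m K : ℕ}

/-! ## 1. Splitting a partial slope at a threshold value (the `…ScaleSeparation` lemmas on a column set `T`, by value) -/

/-- three-way split of `Σ_{i ∈ T} d (r i)` at a threshold value `D₀`: exponents above, equal to (`D₀ · #`), and below `D₀`.
[folklore] -/
theorem sum_d_split3_on (d : Fin K → ℕ) (r : Fin m → Fin K) (D₀ : ℕ) (T : Finset (Fin m)) :
    ∑ i ∈ T, d (r i) = ∑ i ∈ T.filter (fun i => D₀ < d (r i)), d (r i) +
      D₀ * (T.filter fun i => d (r i) = D₀).card + ∑ i ∈ T.filter (fun i => d (r i) < D₀), d (r i) := by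
  rw [← sum_filter_add_sum_filter_not T (fun i => D₀ < d (r i))]
  rw [add_assoc]
  congr 1
  rw [← sum_filter_add_sum_filter_not (T.filter fun i => ¬ D₀ < d (r i)) (fun i => d (r i) = D₀)]
  rw [filter_filter, filter_filter]
  congr 1
  · rw [sum_congr rfl (fun i hi => ((mem_filter.mp hi).2.2 : d (r i) = D₀)), sum_const, smul_eq_mul, mul_comm]
    congr 2
    ext i
    simp only [mem_filter]
    constructor
    · exact fun h => ⟨h.1, h.2.2⟩
    · intro h; exact ⟨h.1, by omega, h.2⟩
  · apply sum_congr _ (fun _ _ => rfl)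
    ext i
    simp only [mem_filter]
    constructor
    · rintro ⟨hi, h1, h2⟩; exact ⟨hi, by omega⟩
    · rintro ⟨hi, h⟩; exact ⟨hi, by omega, by omega⟩

/-- the part of a partial slope above `D₀` only depends on the `T`-counts of the exponent VALUES `> D₀`. [folklore] -/
theorem sum_above_eq_of_countVal_on (d : Fin K → ℕ) (r r' : Fin m → Fin K) (D₀ : ℕ) (T : Finset (Fin m))
    (hagree : ∀ D' : ℕ, D₀ < D' → (T.filter fun i => d (r i) = D').card = (T.filter fun i => d (r' i) = D').card) :
    ∑ i ∈ T.filter (fun i => D₀ < d (r i)), d (r i) = ∑ i ∈ T.filter (fun i => D₀ < d (r' i)), d (r' i) := by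
  classical
  -- regroup both sums by value
  have key : ∀ s : Fin m → Fin K, ∑ i ∈ T.filter (fun i => D₀ < d (s i)), d (s i) =
      ∑ D' ∈ (univ.image d).filter (fun D' => D₀ < D'), (T.filter fun i => d (s i) = D').card * D' := by
    intro s
    rw [← sum_fiberwise_of_maps_to (s := T.filter fun i => D₀ < d (s i)) (t := (univ.image d).filter fun D' => D₀ < D')
      (g := fun i => d (s i)) (fun i hi => mem_filter.2 ⟨mem_image_of_mem d (mem_univ _), (mem_filter.1 hi).2⟩)
      (fun i => d (s i))]
    refine sum_congr rfl fun D' hD' => ?_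
    have hD'' : D₀ < D' := (mem_filter.1 hD').2
    rw [filter_filter, sum_congr rfl (fun i hi => by rw [(mem_filter.mp hi).2.2] : ∀ i ∈ T.filter
        (fun i => D₀ < d (s i) ∧ d (s i) = D'), d (s i) = D'), sum_const, smul_eq_mul]
    congr 2
    ext i
    simp only [mem_filter]
    constructor
    · exact fun hh => ⟨hh.1, hh.2.2⟩
    · intro hh; exact ⟨hh.1, hh.2 ▸ hD'', hh.2⟩
  rw [key r, key r']
  exact sum_congr rfl fun D' hD' => by rw [hagree D' (mem_filter.1 hD').2]

/-- the part of a partial slope below `D₀ = d t` is small under super-increasing values. [folklore] -/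
theorem sum_below_bound_on (d : Fin K → ℕ) (hsup : ∀ l l' : Fin K, d l < d l' → m * d l < d l') (r : Fin m → Fin K)
    (t : Fin K) (T : Finset (Fin m)) :
    m * ∑ i ∈ T.filter (fun i => d (r i) < d t), d (r i) + (T.filter fun i => d (r i) < d t).card ≤
      (T.filter fun i => d (r i) < d t).card * d t := by
  rw [mul_sum, card_eq_sum_ones, sum_mul, ← sum_add_distrib]
  refine sum_le_sum fun i hi => ?_
  have := hsup (r i) t (mem_filter.mp hi).2
  omega

/-! ## 2. The lex law on an invariant column set -/

/-- **THE LEX LAW ON AN INVARIANT PART.**  Exponent values super-increasing by the size; `(σ₁, λ₁)` the unique optimum at `θa`,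
`(σ₂, λ₂)` the unique optimum at `θb > θa`; `T` a column set invariant under `σ₁⁻¹σ₂` (a union of cycles of the step) on which the
two terms differ; `d t` an exponent value such that the two terms have equally many `T`-columns of every exponent value `> d t`.
Then the number of `T`-columns of exponent value `d t` does not drop: the `T`-part of the value profile moves lexicographically,
part by part.  (With `T = univ` this is `TropicalCensus.countVal_le_of_dominant_lex`, up to phrasing the hypothesis by values.)
[folklore: cyclewise slope law + scale separation] -/
theorem countVal_le_of_dominant_lex_on (d : Fin K → ℕ) (hsup : ∀ l l' : Fin K, d l < d l' → m * d l < d l')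
    (v ε : Fin m → Fin m → Fin K → ℤ) {θa θb : ℤ} (hab : θa < θb) {σ₁ σ₂ : Equiv.Perm (Fin m)} {l₁ l₂ : Fin m → Fin K}
    (ha : IsDominant d v ε θa (σ₁, l₁)) (hb : IsDominant d v ε θb (σ₂, l₂)) (T : Finset (Fin m))
    (hT : ∀ b, (σ₁⁻¹ * σ₂) b ∈ T ↔ b ∈ T) (hne : ∃ b ∈ T, σ₁ b ≠ σ₂ b ∨ l₁ b ≠ l₂ b) (t : Fin K)
    (hagree : ∀ D' : ℕ, d t < D' →
      (T.filter fun i => d (l₁ i) = D').card = (T.filter fun i => d (l₂ i) = D').card) :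
    (T.filter fun i => d (l₁ i) = d t).card ≤ (T.filter fun i => d (l₂ i) = d t).card := by
  classical
  set D₀ := d t with hD₀
  by_contra hcon
  push Not at hcon
  have hslopeZ := sum_d_lt_of_isDominant_invariant d v ε hab ha hb T hT hne
  have hslope : ∑ i ∈ T, d (l₁ i) < ∑ i ∈ T, d (l₂ i) := by exact_mod_cast hslopeZ
  rw [sum_d_split3_on d l₁ D₀ T, sum_d_split3_on d l₂ D₀ T, sum_above_eq_of_countVal_on d l₁ l₂ D₀ T hagree] at hslope
  -- names
  set cp := (T.filter fun i => d (l₁ i) = D₀).card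
  set cq := (T.filter fun i => d (l₂ i) = D₀).card
  set Bp := ∑ i ∈ T.filter (fun i => d (l₁ i) < D₀), d (l₁ i)
  set Bq := ∑ i ∈ T.filter (fun i => d (l₂ i) < D₀), d (l₂ i)
  set nb := (T.filter fun i => d (l₂ i) < D₀).card
  -- the slope law now reads `D₀·cp + Bp < D₀·cq + Bq`
  have h1 : D₀ * cp + Bp < D₀ * cq + Bq := by omega
  have hbelow : m * Bq + nb ≤ nb * D₀ := sum_below_bound_on d hsup l₂ t T
  have hnb : nb ≤ m := by
    have := (card_filter_le T (fun i => d (l₂ i) < D₀)).trans (card_le_univ T)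
    rwa [Fintype.card_fin] at this
  rcases Nat.eq_zero_or_pos m with hm | hm
  · subst hm
    have h0 : cp = 0 := by
      have := (card_filter_le T (fun i => d (l₁ i) = D₀)).trans (card_le_univ T)
      rw [Fintype.card_fin] at this
      omega
    omega
  -- `m · Bq < m · D₀` unless there is no column below, in which case `Bq = 0`
  rcases Nat.eq_zero_or_pos nb with hnb0 | hnb0
  · have hBq : Bq = 0 := by
      have : (T.filter fun i => d (l₂ i) < D₀) = ∅ := card_eq_zero.mp hnb0
      simp only [Bq, this, sum_empty]
    have : D₀ * cp < D₀ * cq := by omega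
    have := Nat.lt_of_mul_lt_mul_left this
    omega
  · have h2 : m * Bq < m * D₀ := by
      have := Nat.mul_le_mul_right D₀ hnb
      omega
    have h3 : m * (D₀ * cp) < m * (D₀ * cq) + m * D₀ := by
      have := Nat.mul_lt_mul_of_pos_left h1 hm
      rw [Nat.mul_add, Nat.mul_add] at this
      omega
    have h4 : m * (D₀ * cq) + m * D₀ ≤ m * (D₀ * cp) := by
      rw [← Nat.mul_add, ← Nat.mul_succ]
      exact Nat.mul_le_mul_left _ (Nat.mul_le_mul_left _ hcon)
    omega

/-! ## 3. Locality: no part of the step touches a value above the leading value -/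

/-- value counts on `T` of two terms that agree on `T` coincide. [folklore] -/
theorem countVal_eq_of_agree_on (d : Fin K → ℕ) {σ₁ σ₂ : Equiv.Perm (Fin m)} {l₁ l₂ : Fin m → Fin K} (T : Finset (Fin m))
    (hag : ∀ b ∈ T, σ₁ b = σ₂ b ∧ l₁ b = l₂ b) (D' : ℕ) :
    (T.filter fun i => d (l₁ i) = D').card = (T.filter fun i => d (l₂ i) = D').card := by
  congr 1
  ext i
  simp only [mem_filter]
  constructor
  · rintro ⟨hi, h⟩; exact ⟨hi, (hag i hi).2 ▸ h⟩
  · rintro ⟨hi, h⟩; exact ⟨hi, (hag i hi).2.symm ▸ h⟩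

/-- value counts split over `T` and `Tᶜ`. [folklore] -/
theorem countVal_split (d : Fin K → ℕ) (s : Fin m → Fin K) (T : Finset (Fin m)) (D' : ℕ) :
    (univ.filter fun i => d (s i) = D').card =
      (T.filter fun i => d (s i) = D').card + (Tᶜ.filter fun i => d (s i) = D').card := by
  classical
  rw [← card_union_of_disjoint (disjoint_filter_filter (disjoint_compl_right (a := T))), ← filter_union,
    union_compl]

/-- **ODOMETER LOCALITY.**  Exponent values super-increasing by the size; `(σ₁, λ₁)` dominant at `θa`, `(σ₂, λ₂)` dominant at
`θb > θa`.  If on ALL columns the two terms have equally many columns of every exponent value `> D` (the step's leading value is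
`≤ D`), then on every column set `T` invariant under `σ₁⁻¹σ₂` they have equally many `T`-columns of every exponent value `> D`:
no cycle of the step relocates a value above the leading one. [folklore] -/
theorem countAbove_eq_on (d : Fin K → ℕ) (hsup : ∀ l l' : Fin K, d l < d l' → m * d l < d l')
    (v ε : Fin m → Fin m → Fin K → ℤ) {θa θb : ℤ} (hab : θa < θb) {σ₁ σ₂ : Equiv.Perm (Fin m)} {l₁ l₂ : Fin m → Fin K}
    (ha : IsDominant d v ε θa (σ₁, l₁)) (hb : IsDominant d v ε θb (σ₂, l₂)) (D : ℕ)
    (hagree : ∀ D' : ℕ, D < D' →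
      (univ.filter fun i => d (l₁ i) = D').card = (univ.filter fun i => d (l₂ i) = D').card)
    (T : Finset (Fin m)) (hT : ∀ b, (σ₁⁻¹ * σ₂) b ∈ T ↔ b ∈ T) :
    ∀ D' : ℕ, D < D' → (T.filter fun i => d (l₁ i) = D').card = (T.filter fun i => d (l₂ i) = D').card := by
  classical
  -- if the terms agree on `T` there is nothing to prove
  by_cases hdiff : ∃ b ∈ T, σ₁ b ≠ σ₂ b ∨ l₁ b ≠ l₂ b
  swap
  · push Not at hdiff
    exact fun D' _ => countVal_eq_of_agree_on d T hdiff D'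
  -- the complement is invariant too
  have hTc : ∀ b, (σ₁⁻¹ * σ₂) b ∈ Tᶜ ↔ b ∈ Tᶜ := fun b => by rw [mem_compl, mem_compl, not_iff_not]; exact hT b
  -- values that are not exponents have empty fibres
  have hzero : ∀ (s : Fin m → Fin K) (S : Finset (Fin m)) (D' : ℕ), (∀ l, d l ≠ D') →
      (S.filter fun i => d (s i) = D').card = 0 := by
    intro s S D' h
    rw [card_eq_zero, filter_eq_empty_iff]
    exact fun i _ => h (s i)
  -- descending induction: all values `> M − j` agree on `T`, where `M` bounds the exponents
  set M := univ.sup d with hM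
  have hdM : ∀ l, d l ≤ M := fun l => le_sup (f := d) (mem_univ l)
  suffices main : ∀ j : ℕ, ∀ D' : ℕ, D < D' → M - j < D' →
      (T.filter fun i => d (l₁ i) = D').card = (T.filter fun i => d (l₂ i) = D').card by
    intro D' hD'
    exact main M D' hD' (by omega)
  intro j
  induction j with
  | zero =>
    intro D' _ hD'
    rw [hzero l₁ T D' (fun l h => by have := hdM l; omega), hzero l₂ T D' (fun l h => by have := hdM l; omega)]
  | succ j ih =>
    intro D' hDD' hD'
    by_cases hlt : M - j < D'
    · exact ih D' hDD' hlt
    -- `D'` is the new value; everything strictly above it agrees on `T` (ih) and on `Tᶜ` (total minus `T`)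
    have hT' : ∀ E : ℕ, D' < E → (T.filter fun i => d (l₁ i) = E).card = (T.filter fun i => d (l₂ i) = E).card :=
      fun E hE => ih E (by omega) (by omega)
    have hTc' : ∀ E : ℕ, D' < E → (Tᶜ.filter fun i => d (l₁ i) = E).card = (Tᶜ.filter fun i => d (l₂ i) = E).card := by
      intro E hE
      have h1 := hagree E (by omega)
      have h2 := hT' E hE
      rw [countVal_split d l₁ T E, countVal_split d l₂ T E] at h1
      omega
    -- is `D'` an exponent value at all?
    by_cases hval : ∃ t : Fin K, d t = D'
    swap
    · push Not at hval
      rw [hzero l₁ T D' hval, hzero l₂ T D' hval]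
    obtain ⟨t, rfl⟩ := hval
    -- lex law on `T` and on `Tᶜ`
    have vT : (T.filter fun i => d (l₁ i) = d t).card ≤ (T.filter fun i => d (l₂ i) = d t).card :=
      countVal_le_of_dominant_lex_on d hsup v ε hab ha hb T hT hdiff t hT'
    have vTc : (Tᶜ.filter fun i => d (l₁ i) = d t).card ≤ (Tᶜ.filter fun i => d (l₂ i) = d t).card := by
      by_cases hdiffc : ∃ b ∈ Tᶜ, σ₁ b ≠ σ₂ b ∨ l₁ b ≠ l₂ b
      · exact countVal_le_of_dominant_lex_on d hsup v ε hab ha hb Tᶜ hTc hdiffc t hTc'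
      · push Not at hdiffc
        exact (countVal_eq_of_agree_on d Tᶜ hdiffc (d t)).le
    have vtot := hagree (d t) hDD'
    rw [countVal_split d l₁ T (d t), countVal_split d l₂ T (d t)] at vtot
    omega

/-- **Fast steps are fast cycle by cycle** (the lowest value): under the hypotheses of `countAbove_eq_on`, on every invariant
part `T` on which the terms differ the count of the value `d t` does not drop either, for every exponent value `d t` — in
particular at the leading value itself (apply the lex law on `T` with the agreement above `D` transported to `T`).  So each cycle of
a lex step either is untouched or moves the value profile of its own columns lexicographically UP at a value `≤ D`. [folklore] -/
theorem countVal_le_on_of_countAbove_eq (d : Fin K → ℕ) (hsup : ∀ l l' : Fin K, d l < d l' → m * d l < d l')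
    (v ε : Fin m → Fin m → Fin K → ℤ) {θa θb : ℤ} (hab : θa < θb) {σ₁ σ₂ : Equiv.Perm (Fin m)} {l₁ l₂ : Fin m → Fin K}
    (ha : IsDominant d v ε θa (σ₁, l₁)) (hb : IsDominant d v ε θb (σ₂, l₂)) (D : ℕ)
    (hagree : ∀ D' : ℕ, D < D' →
      (univ.filter fun i => d (l₁ i) = D').card = (univ.filter fun i => d (l₂ i) = D').card)
    (T : Finset (Fin m)) (hT : ∀ b, (σ₁⁻¹ * σ₂) b ∈ T ↔ b ∈ T) (hne : ∃ b ∈ T, σ₁ b ≠ σ₂ b ∨ l₁ b ≠ l₂ b)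
    (t : Fin K) (ht : D ≤ d t) :
    (T.filter fun i => d (l₁ i) = d t).card ≤ (T.filter fun i => d (l₂ i) = d t).card :=
  countVal_le_of_dominant_lex_on d hsup v ε hab ha hb T hT hne t
    (fun D' hD' => countAbove_eq_on d hsup v ε hab ha hb D hagree T hT D' (lt_of_le_of_lt ht hD'))

end OdometerLocality

end Summit.ValiantsHypothesis.ValiantsHypothesis.Theorems.KPlusLogSqLaw
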